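import Mathlib
import HarnessLib
import Summits.HubbardSuperconductivity.HubbardSuperconductivity.Theorems.KLProgrammeKLRegimeEngineV8TowerCoreDefsCG

/-!
# K3 ENGINE (stmt-HubbardSuperconductivity-20437 `KLRegimeEngineV17F2`), stub (b) v2 (ℓ): the UNCAPPED atom-free core tower package with the c-slot DEFERRED AT A
# GEOMETRY SLOT `G`, and its closer-facing row at ANY raise `Q` of `klEngQ8 P R` whose `CE` absorbs the package's constant — registrant PRESTAGE for the option of
# folding the token-#13 motion (α1) «(ℓ)-CE-CAP» into the «A24∪A25» rev-15 motion (plan g24 (R269)(C) word asked of p1b; G := `klEngGeo14` elect);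
# cell gate-hubbard-kl, seat gate-hubbard-kl-p1b g16 (20437 v2 registrant lineage)

WHY.  D4 §2 (`…TowerCoreDefsC`, p640134) defers the UNCAPPED package `klTowerCorePkgC P R` over `TowerCoreStepV2 klEngGeo11 …` — frozen G token; D4G (p664520) moved only
the CAPPED package (§3/§4) to a geometry slot.  (α1) = let token #13's `CE` absorb the uncapped package's constant (so E1's tree-expansion constant is free); under the
G elect `klEngGeo14` that constant is the one of the package deferred AT `klEngGeo14`.  This file:
* §1 **`klTowerCorePkgCG G P R`** over `∃ e, IsTowerPkgC e ∧ TowerCoreStepV2 G P R (klEngQ8 P R) e.1 e.2.1 e.2.2` (default `(klTowerCoreCE P R, 1, 1)`), projections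
  **`klTowerCoreCECG / klTowerCoreUCG / klTowerCoreCCG`**, unconditional rows (`_nonneg`, `_pos`), `choose_spec` rows, else-branch reader; `klTowerCorePkgCG_klEngGeo11 :
  klTowerCorePkgCG klEngGeo11 P R = klTowerCorePkgC P R` (`rfl` — D4 §2 is the instance);
* §2 **`towerCoreCG_at`** — the closer-facing row at ANY `Q` with `(klEngQ8 P R).IsRaiseOf Q` and `klTowerCoreCECG G P R ≤ Q.CE` (the CE-joint as a HYPOTHESIS, discharged
  by a token-#13 successor's row, e.g. `klTowerCoreCECG_le_klEngQ9dG_CE` of `…DefsQ9dG`): stub (b)'s binders at `(G, Q)` ⇒ levels at every `1 ≤ j ≤ n` ∧ `EngineFirstMoments … G … Q`.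
NOT A MOTION: nothing registers, no token of record moves; the producer statement is a HYPOTHESIS slot.  Definitions with bodies + bookkeeping rows; nothing about the
model is asserted; nothing asserts (b), (ℓ), any stub of 20437, K3 or superconductivity.
-/

noncomputable section

namespace Summit.HubbardSuperconductivity.HubbardSuperconductivity.Theorems.EngineV8

set_option linter.dupNamespace false -- summit = problem name (single-conjunct summit), D-0017

open Real Finset Literature.MathematicalPhysics.QuantumLattice Literature.Probability.LatticeModels
open Literature.MathematicalPhysics.QuantumLattice.FermiRG
open Summit.HubbardSuperconductivity.HubbardSuperconductivity.Theorems.KLRegimeSplit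
open Summit.HubbardSuperconductivity.HubbardSuperconductivity.Theorems.KLProgrammeLegKernels
open Summit.HubbardSuperconductivity.HubbardSuperconductivity.Theorems.DispersionFlow

/-! ## §1 The UNCAPPED core-C package deferred at a geometry slot `G` -/

section UncappedG

variable (G : GeoConsts) (P : SplitConsts) (R : RenConsts)

/-- **`klTowerCorePkgCG G P R`**: SOME admissible `(CE, u, cT)` with `TowerCoreStepV2 G P R (klEngQ8 P R) CE u cT`, if one exists, ELSE the default
`(klTowerCoreCE P R, fun _ _ => 1, 1)` (admissible in both branches).  At `G := klEngGeo11` this is D4 §2's `klTowerCorePkgC P R`. -/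
def klTowerCorePkgCG : ℝ × (EngConsts → ℝ → ℝ) × ℝ :=
  open scoped Classical in
  if h : ∃ e : ℝ × (EngConsts → ℝ → ℝ) × ℝ, IsTowerPkgC e ∧ TowerCoreStepV2 G P R (klEngQ8 P R) e.1 e.2.1 e.2.2 then Classical.choose h
  else (klTowerCoreCE P R, fun _ _ => 1, 1)

/-- **The uncapped core-C constant at `G`**: `klTowerCoreCECG G P R := (klTowerCorePkgCG G P R).1` (what a token-#13 successor `… ⊔ klTowerCoreCECG G P R` absorbs). -/
def klTowerCoreCECG : ℝ := (klTowerCorePkgCG G P R).1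

/-- **The uncapped core-C coupling threshold at `G`**: `klTowerCoreUCG G P R := (klTowerCorePkgCG G P R).2.1`. -/
def klTowerCoreUCG : EngConsts → ℝ → ℝ := (klTowerCorePkgCG G P R).2.1

/-- **The uncapped core-C regime-constant threshold at `G`**: `klTowerCoreCCG G P R := (klTowerCorePkgCG G P R).2.2`. -/
def klTowerCoreCCG : ℝ := (klTowerCorePkgCG G P R).2.2

/-- **CONSISTENCY WITH D4 §2**: `klTowerCorePkgCG klEngGeo11 P R = klTowerCorePkgC P R` (`rfl`). -/
theorem klTowerCorePkgCG_klEngGeo11 : klTowerCorePkgCG klEngGeo11 P R = klTowerCorePkgC P R := rfl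

/-- `klTowerCoreCECG klEngGeo11 P R = klTowerCoreCEC P R` (`rfl`). -/
theorem klTowerCoreCECG_klEngGeo11 : klTowerCoreCECG klEngGeo11 P R = klTowerCoreCEC P R := rfl

/-- `klTowerCoreUCG klEngGeo11 P R = klTowerCoreUC P R` (`rfl`). -/
theorem klTowerCoreUCG_klEngGeo11 : klTowerCoreUCG klEngGeo11 P R = klTowerCoreUC P R := rfl

/-- `klTowerCoreCCG klEngGeo11 P R = klTowerCoreCC P R` (`rfl`). -/
theorem klTowerCoreCCG_klEngGeo11 : klTowerCoreCCG klEngGeo11 P R = klTowerCoreCC P R := rfl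

/-- The G-slotted uncapped package is admissible (unconditionally). -/
theorem isTowerPkgC_klTowerCorePkgCG : IsTowerPkgC (klTowerCorePkgCG G P R) := by
  classical
  unfold klTowerCorePkgCG
  split_ifs with h
  · exact (Classical.choose_spec h).1
  · exact ⟨klTowerCoreCE_nonneg P R, fun _ _ => one_pos, one_pos⟩

/-- `0 ≤ klTowerCoreCECG G P R`. -/
theorem klTowerCoreCECG_nonneg : 0 ≤ klTowerCoreCECG G P R := (isTowerPkgC_klTowerCorePkgCG G P R).1

/-- `0 < klTowerCoreUCG G P R Q cc` (unconditionally). -/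
theorem klTowerCoreUCG_pos (Q : EngConsts) (cc : ℝ) : 0 < klTowerCoreUCG G P R Q cc := (isTowerPkgC_klTowerCorePkgCG G P R).2.1 Q cc

/-- `0 < klTowerCoreCCG G P R` (unconditionally). -/
theorem klTowerCoreCCG_pos : 0 < klTowerCoreCCG G P R := (isTowerPkgC_klTowerCorePkgCG G P R).2.2

variable {G P R}

/-- The V2 core AT `G` holds for the G-slotted uncapped package as soon as some admissible witness exists (`choose_spec`). -/
theorem towerCoreStepV2_klTowerCoreCG_of_exists
    (h : ∃ e : ℝ × (EngConsts → ℝ → ℝ) × ℝ, IsTowerPkgC e ∧ TowerCoreStepV2 G P R (klEngQ8 P R) e.1 e.2.1 e.2.2) :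
    TowerCoreStepV2 G P R (klEngQ8 P R) (klTowerCoreCECG G P R) (klTowerCoreUCG G P R) (klTowerCoreCCG G P R) := by
  classical
  have hpkg : klTowerCorePkgCG G P R = Classical.choose h := by
    unfold klTowerCorePkgCG
    rw [dif_pos h]
  unfold klTowerCoreCECG klTowerCoreUCG klTowerCoreCCG
  rw [hpkg]
  exact (Classical.choose_spec h).2

/-- Packaging an explicit witness `(CE, u, cT)` at `G` (NO cap on `CE`). -/
theorem towerCoreStepV2_klTowerCoreCG_of {CE : ℝ} {u : EngConsts → ℝ → ℝ} {cT : ℝ} (hCE : 0 ≤ CE) (hu : ∀ Q cc, 0 < u Q cc) (hcT : 0 < cT)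
    (hs : TowerCoreStepV2 G P R (klEngQ8 P R) CE u cT) :
    TowerCoreStepV2 G P R (klEngQ8 P R) (klTowerCoreCECG G P R) (klTowerCoreUCG G P R) (klTowerCoreCCG G P R) :=
  towerCoreStepV2_klTowerCoreCG_of_exists ⟨(CE, u, cT), ⟨hCE, hu, hcT⟩, hs⟩

/-- ELSE branch: with no admissible witness at `G` the package IS the default. -/
theorem klTowerCorePkgCG_of_not_exists
    (h : ¬ ∃ e : ℝ × (EngConsts → ℝ → ℝ) × ℝ, IsTowerPkgC e ∧ TowerCoreStepV2 G P R (klEngQ8 P R) e.1 e.2.1 e.2.2) :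
    klTowerCorePkgCG G P R = (klTowerCoreCE P R, fun _ _ => 1, 1) := by
  classical
  unfold klTowerCorePkgCG
  rw [dif_neg h]

/-- A CAPPED witness is in particular an uncapped one: the capped ∃-statement at `G` (D4G's hypothesis) implies the uncapped one (this file's). -/
theorem exists_towerCorePkgCG_of_capped
    (h : ∃ e : ℝ × (EngConsts → ℝ → ℝ) × ℝ, IsTowerPkgC e ∧ e.1 ≤ klEngQ9cCE P R ∧ TowerCoreStepV2 G P R (klEngQ8 P R) e.1 e.2.1 e.2.2) :
    ∃ e : ℝ × (EngConsts → ℝ → ℝ) × ℝ, IsTowerPkgC e ∧ TowerCoreStepV2 G P R (klEngQ8 P R) e.1 e.2.1 e.2.2 := by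
  obtain ⟨e, he, -, hs⟩ := h
  exact ⟨e, he, hs⟩

end UncappedG

/-! ## §2 The closer-facing row at a geometry slot `G` and ANY raise `Q` of `klEngQ8 P R` whose `CE` absorbs the package's constant -/

/-- **THE GEO- AND OSC-JOINTS CLOSE BY NAME AT ANY `(G, Q)`; THE CE-JOINT IS THE HYPOTHESIS `klTowerCoreCECG G P R ≤ Q.CE`.**  From the uncapped core ∃-statement AT
`G` and stub (b)'s binders under a `(G, Q)`-keyed image — `0 < c ≤ klEngC₃6 P R`, `c ≤ klTowerCoreCCG G P R` (c-chain row), `U ≤ klEngU₀10 P R c`, `U ≤ klTowerCoreUCG G P R Q c`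
(u-chain row), the v2 doors, `1 ≤ n ≤ n_β + 1`, the regime, the public history AT `(G, Q)`, the (K5′) clause, `K_n` admissible, the class-#1 exports — the levels bundle at
every `1 ≤ j ≤ n` and `EngineFirstMoments` at `K_n`, AT `(G, Q)`.  For a token-#13 successor `Q := klEngQ9dG G P R` the two hypotheses are `isRaiseOf_klEngQ9dG_klEngQ8` and
`klTowerCoreCECG_le_klEngQ9dG_CE` (…DefsQ9dG). -/
theorem towerCoreCG_at {G : GeoConsts} {P : SplitConsts} {R : RenConsts} {Q : EngConsts}
    (hex : ∃ e : ℝ × (EngConsts → ℝ → ℝ) × ℝ, IsTowerPkgC e ∧ TowerCoreStepV2 G P R (klEngQ8 P R) e.1 e.2.1 e.2.2)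
    (hQ : (klEngQ8 P R).IsRaiseOf Q) (hCEQ : klTowerCoreCECG G P R ≤ Q.CE)
    {c μ U β : ℝ} {L M : ℕ} [NeZero L] [NeZero M] {n : ℕ}
    (hc : 0 < c) (hc36 : c ≤ klEngC₃6 P R) (hcT : c ≤ klTowerCoreCCG G P R) (hμ : μ ∈ klWindowC) (hU : 0 < U) (hU10 : U ≤ klEngU₀10 P R c)
    (hUu : U ≤ klTowerCoreUCG G P R Q c) (hβ : klBetaMin ≤ β) (hβc : β ≤ Real.exp (c / U ^ 2))
    (hL : klEngL₄ P R β U ≤ L) (hM : klEngM₃ β U L ≤ M) (hn1 : 1 ≤ n) (hn : n ≤ nScales β + 1) (hreg : IsKLRegime U c (-(n : ℤ)))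
    (hhist : HistP klPredsV17F2 L M G P Q R β U μ 0 n)
    (hosc : ∀ m, 1 ≤ m → m < n → FlowPieceOscAt L M (klReadOscC P R) β U μ m)
    (hfr : FrameOK R U (nScales β) μ (klFlowFrameU L M β U μ n))
    (hlevU : ∀ j ≤ n, LevelsUExportMixedAt L M (klCU2 P R (klEngQ7 P R)) P β U μ j) :
    (∀ j : ℕ, 1 ≤ j → j ≤ n →
      KernelNormsLevels L M P Q β U μ (klFlowFrameU L M β U μ n) j ∧
        KernelNormsWt4 L M (klWtBudget P Q U j) β U μ (klFlowFrameU L M β U μ n) j) ∧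
    EngineFirstMoments L M G P Q β U μ (klFlowFrameU L M β U μ n) n := by
  have h := towerCoreStepV2_klTowerCoreCG_of_exists hex
  exact ⟨h.1 Q hQ hCEQ c hc hc36 hcT μ hμ U hU hU10 hUu β hβ hβc L M hL hM n hn1 hn hreg hhist hosc hfr hlevU,
    h.2 Q hQ hCEQ c hc hc36 μ hμ U hU hU10 hUu β hβ hβc L M hL hM n hn1 hn hreg hhist hosc hfr hlevU⟩

end Summit.HubbardSuperconductivity.HubbardSuperconductivity.Theorems.EngineV8

end
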